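import Summits.QuantumFields.YangMills.Theorems.BalabanLadderNTOnePointFloor
import HarnessLib

/-!
# Crux `NT` (stmt-QuantumFields-19353): no exterior freezes a region — the kernel mean of the region's Wilson action is at least
# `(#links) · θ/(8β)`, uniformly in the boundary condition (hypothesis-free)

Fleet lead prover of crux `NT` (unit `ym-spine-19353-p1`, g9).  Sequel of `Theorems/BalabanLadderNTOnePointFloor`
(`kernel_linkAction_ge_of_mem`: inside every finite-volume lattice Yang–Mills kernel `γ_Λ(· | η)` every link `e ∈ Λ` has
`∫ S_e dγ_Λ(·|η) ≥ θ/(2β)`).  Summing over the links of `Λ` and double counting (`Σ_{e ∈ Λ} S_e ≤ 4 S_Λ`: a plaquette has four links,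
its cost is non-negative):

* `sum_wilsonBoundaryAction_singleton_le` — `Σ_{e ∈ Λ} S_{e}(U) ≤ 4 · S_Λ(U)` for every configuration;
* **`kernel_action_ge_card`** — for a compact group with a faithful continuous unitary representation of positive dimension there
  are `θ, β₀ > 0` with: for every `β ≥ β₀`, every dimension `d`, every finite link set `Λ` all of whose links lie on a plaquette, and
  EVERY exterior `η`: `(#Λ) · θ/(8β) ≤ ∫ S_Λ dγ_Λ(· | η)`, `S_Λ = Σ_{p ∩ Λ ≠ ∅} (N − Re tr ρ(U_p))` — in the currency of `RefPkgT`
  clause 1 (one-point laws of the cube kernels, uniformly in the exterior) this is the FLOOR: the equipartition energy `∝ #links/β`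
  is present in every cube whatever the boundary condition; the clause's open content is the CEILING side (LEAD-20043 #50).

HONEST FRAMING.  Equipartition from below, per region, uniformly in the exterior; nothing about decay in the depth, NT, the seam or
the gap; not Clay.  Refs: Seiler LNP 159 Ch. 2 (DLR kernels); Montvay–Münster 1994 §3.2.
-/

set_option autoImplicit false

noncomputable section

open MeasureTheory Measure Filter Set ProbabilityTheory
open scoped BigOperators
open Literature.MathematicalPhysics.QuantumLattice
open Literature.MathematicalPhysics.QuantumFieldTheory hiding ZdEdge
open Summit.QuantumFields.YangMills.Theorems.FreeEnergyLogCoefficient (dimE)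

namespace Summit.QuantumFields.YangMills.Cruxes.NT.LinkEquipartition

section Region

variable {N : ℕ} {G : Type*} [Group G] [TopologicalSpace G] [IsTopologicalGroup G] [CompactSpace G]
  [MeasurableSpace G] [BorelSpace G] [SecondCountableTopology G] (ρ : G →* Matrix (Fin N) (Fin N) ℂ)

omit [TopologicalSpace G] [IsTopologicalGroup G] [CompactSpace G] [MeasurableSpace G] [BorelSpace G]
  [SecondCountableTopology G] in
/-- A plaquette has at most four links. [folklore] -/
theorem card_plaquetteEdges_le {d : ℕ} (p : ZdPlaquette d) : (plaquetteEdges p).card ≤ 4 := by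
  classical
  rw [plaquetteEdges_eq]
  refine (Finset.card_insert_le _ _).trans ?_
  refine (Nat.succ_le_succ (Finset.card_insert_le _ _)).trans ?_
  refine (Nat.succ_le_succ (Nat.succ_le_succ (Finset.card_insert_le _ _))).trans ?_
  simp

omit [TopologicalSpace G] [IsTopologicalGroup G] [CompactSpace G] [MeasurableSpace G] [BorelSpace G]
  [SecondCountableTopology G] in
/-- **Double counting: `Σ_{e ∈ Λ} S_{e}(U) ≤ 4 S_Λ(U)`** — each plaquette touching `Λ` is counted once per link it has in `Λ`
(at most four times) and its cost `N − Re tr ρ(U_p)` is non-negative. [folklore] -/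
theorem sum_wilsonBoundaryAction_singleton_le {d : ℕ} (hU : ∀ g, ρ g ∈ Matrix.unitaryGroup (Fin N) ℂ)
    (Λ : Finset (ZdEdge d)) (U : LGConfig d G) :
    ∑ e ∈ Λ, wilsonBoundaryAction ρ {e} U ≤ 4 * wilsonBoundaryAction ρ Λ U := by
  classical
  unfold wilsonBoundaryAction
  set f : ZdPlaquette d → ℝ := fun p => (N : ℝ) - plaquetteObs ρ p.1 p.2.1.1 p.2.1.2 U with hf
  have hf0 : ∀ p, 0 ≤ f p := fun p => by
    have h := (abs_le.1 (abs_plaquetteObs_le_holds ρ hU p.1 p.2.1.1 p.2.1.2 U)).2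
    rw [hf]; linarith
  -- exchange the sums: pairs `(e, p)` with `e ∈ Λ`, `e ∈ ∂p`
  have hswap : ∑ e ∈ Λ, ∑ p ∈ plaquettesTouching {e}, f p =
      ∑ p ∈ plaquettesTouching Λ, ∑ e ∈ Λ.filter (fun e => e ∈ plaquetteEdges p), f p := by
    refine Finset.sum_comm' fun e p => ?_
    rw [mem_plaquettesTouching_singleton, Finset.mem_filter, mem_plaquettesTouching_iff]
    constructor
    · rintro ⟨he, hep⟩; exact ⟨⟨he, hep⟩, ⟨e, Finset.mem_inter.2 ⟨hep, he⟩⟩⟩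
    · rintro ⟨⟨he, hep⟩, -⟩; exact ⟨he, hep⟩
  rw [hswap, Finset.mul_sum]
  refine Finset.sum_le_sum fun p _ => ?_
  rw [Finset.sum_const, nsmul_eq_mul]
  have hc : ((Λ.filter fun e => e ∈ plaquetteEdges p).card : ℝ) ≤ 4 := by
    have h1 : (Λ.filter fun e => e ∈ plaquetteEdges p).card ≤ (plaquetteEdges p).card :=
      Finset.card_le_card fun e he => (Finset.mem_filter.1 he).2
    exact_mod_cast h1.trans (card_plaquetteEdges_le p)
  exact mul_le_mul_of_nonneg_right hc (hf0 p)

/-- **NO EXTERIOR FREEZES A REGION.**  There are `θ, β₀ > 0` (depending on `(G, ρ)` only) such that for every `β ≥ β₀`, every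
dimension `d`, every finite link set `Λ` each of whose links lies on at least one plaquette, and EVERY exterior `η`:
`(#Λ) θ/(8β) ≤ ∫ S_Λ dγ_Λ(· | η)` — the region's Wilson action (boundary plaquettes included) has kernel mean at least the
equipartition scale `#links/β`, whatever the boundary condition. [folklore] -/
theorem kernel_action_ge_card (hρ : Continuous ρ) (hinj : Function.Injective ρ)
    (hU : ∀ g, ρ g ∈ Matrix.unitaryGroup (Fin N) ℂ) (hD : 0 < dimE ρ) :
    ∃ θ β₀ : ℝ, 0 < θ ∧ 0 < β₀ ∧ ∀ β : ℝ, β₀ ≤ β → ∀ {d : ℕ} (Λ : Finset (ZdEdge d)),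
      (∀ e ∈ Λ, (plaquettesTouching {e}).Nonempty) → ∀ η : LGConfig d G,
        (Λ.card : ℝ) * θ / (8 * β) ≤ ∫ U, wilsonBoundaryAction ρ Λ U ∂(ymSpecification ρ β Λ η) := by
  obtain ⟨θ, β₀, hθ, hβ₀, hker⟩ := kernel_linkAction_ge_of_mem ρ hρ hinj hU hD
  refine ⟨θ, β₀, hθ, hβ₀, fun β hβ d Λ hne η => ?_⟩
  haveI : T2Space G := T2Space.of_injective_continuous hinj hρ
  have hγ := isSpecification_ymSpecification_of_t2Space (d := d) ρ hρ β
  haveI := hγ.isProbability Λ η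
  have hβ0 : 0 < β := hβ₀.trans_le hβ
  -- integrability of the single-link actions and of `S_Λ`
  have hint : ∀ e ∈ Λ, Integrable (wilsonBoundaryAction ρ {e} : LGConfig d G → ℝ) (ymSpecification ρ β Λ η) := fun e _ =>
    Integrable.of_mem_Icc (-(((2 * (d - 1) : ℕ) : ℝ) * (2 * N))) (((2 * (d - 1) : ℕ) : ℝ) * (2 * N))
      (continuous_wilsonBoundaryAction ρ hρ {e}).measurable.aemeasurable
      (ae_of_all _ fun U => abs_le.1 (abs_wilsonBoundaryAction_singleton_le ρ hU e U))
  obtain ⟨C, hC⟩ : ∃ C, ∀ U : LGConfig d G, |wilsonBoundaryAction ρ Λ U| ≤ C := by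
    obtain ⟨C, hC⟩ := (isCompact_univ.image (continuous_wilsonBoundaryAction ρ hρ Λ)).isBounded.exists_norm_le
    exact ⟨C, fun U => hC _ ⟨U, Set.mem_univ _, rfl⟩⟩
  have hintΛ : Integrable (fun U => 4 * wilsonBoundaryAction ρ Λ U) (ymSpecification ρ β Λ η) :=
    (Integrable.of_mem_Icc (-C) C (continuous_wilsonBoundaryAction ρ hρ Λ).measurable.aemeasurable
      (ae_of_all _ fun U => abs_le.1 (hC U))).const_mul 4
  -- sum the link floors and compare with `4 S_Λ`
  have hsum : (Λ.card : ℝ) * (θ / (2 * β)) ≤ ∫ U, ∑ e ∈ Λ, wilsonBoundaryAction ρ {e} U ∂(ymSpecification ρ β Λ η) := by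
    rw [integral_finsetSum _ hint]
    calc (Λ.card : ℝ) * (θ / (2 * β)) = ∑ _e ∈ Λ, θ / (2 * β) := by rw [Finset.sum_const, nsmul_eq_mul]
      _ ≤ _ := Finset.sum_le_sum fun e he => hker β hβ Λ e he η (hne e he)
  have hle : ∫ U, ∑ e ∈ Λ, wilsonBoundaryAction ρ {e} U ∂(ymSpecification ρ β Λ η) ≤
      ∫ U, 4 * wilsonBoundaryAction ρ Λ U ∂(ymSpecification ρ β Λ η) :=
    integral_mono (integrable_finsetSum _ hint) hintΛ fun U => sum_wilsonBoundaryAction_singleton_le ρ hU Λ U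
  rw [integral_const_mul] at hle
  have h := hsum.trans hle
  have e : (Λ.card : ℝ) * θ / (8 * β) = (Λ.card : ℝ) * (θ / (2 * β)) / 4 := by field_simp; ring
  rw [e, div_le_iff₀ (by norm_num : (0 : ℝ) < 4)]
  linarith

end Region

end Summit.QuantumFields.YangMills.Cruxes.NT.LinkEquipartition

end
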